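import Summits.QuantumFields.BalabanUV.T4Continuum.Support.RegularBackgroundTower

/-!
# B13AvgCorrPlaquette — row NE5, κ-DISCHARGE programme (T4-DAG §8 Q49 (a′), dagwriter l.23165; design note
# `HOME/t4/b2b-balaban-t4-ne5-p1/g39/KAPPA-NE5-DESIGN.md`), leaf κ-L2: THE PLAQUETTE OF A UNITARY (α, β)-REGULAR LEVEL IS WITHIN
# `(2β + 2α²)∕(lev L k)²` OF `1` — the finest-plaquette letter that the torus non-abelian Stokes road consumes

Cell `pub-balaban`, unit `b2b-balaban-t4-ne5-p1` (row NE5 OWNER, gen 39; owner item «g39-c»).  Summits-side NEW WORK under the LEAN PLACEMENT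
RULE: [folklore] C⋆-norm algebra of unitary matrices (§1) and its reading in the tower currency of rows NE2 ∕ B5 (§2); 0 `def`, no `Prop`-valued
fact minted, nothing printed asserted, no citation tag.  HONEST FRAMING: rung (B)+1 of the FINITE-VOLUME T⁴ programme — NOT infinite volume, NOT
a mass gap, NOT the Clay problem, NOT a proof of NE5 (NOT PRINTED; GAPS G-t4-U3-1); an elementary estimate on OUR abstract towers, nothing of
[Balaban1985Averaging] ∕ [Balaban1987RG1] instantiated.  HONEST DEPENDENCY (cell, verbatim): continuum YM on T⁴ ⇐ BetaPertH ∧ nine spine estimates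
(0/9 proved); BetaPertH ⇐ (D1) ∧ (D4) ∧ CAP+tail; G-an2-4 gates asym, D1 and NE2/3/4.

WHY.  The κ-letter of the substrate's W-25a∕b (`hκ : dist1 (corr ℰ U_i c) ≤ κ∕ℓ²`, GAPS § G-ne5p1-Javg-reg) is discharged, on the road of record
(design note §2), from a Stokes bound `dist1 (hol w) ≤ area(w)·max_p dist1 (V ∂p)` and a bound on the FINEST plaquettes of the regular window.
The latter is this file: for unitary `a = R_μ(x)`, `b = R_ν(x+e_μ)`, `c = R_μ(x+e_ν)`, `d = R_ν(x)`,
`‖a·b·c⋆·d⋆ − 1‖ = ‖a·b − d·c‖ ≤ ‖[a, b]‖ + ‖b − d‖·‖a‖ + ‖d‖·‖a − c‖ ≤ 2‖a − 1‖‖b − 1‖ + ‖b − d‖ + ‖a − c‖`, i.e. two Lipschitz letters and one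
commutator (size²): `≤ (2β + 2α²)∕(lev L k)²` under `RegularTransporters L M R α β`.
* §1 `norm_mul_unitary` (`CStarRing.norm_mul_mem_unitary`), `norm_commutator_le` (`‖ab − ba‖ ≤ 2‖a − 1‖‖b − 1‖`), `norm_plaquette_sub_one_le`
  (for unitary `c, d`: `‖a·b·c⋆·d⋆ − 1‖ ≤ ‖b − d‖·‖a‖ + ‖a − c‖ + 2‖a − 1‖‖b − 1‖`).
* §2 `norm_sub_one_le_of_reg` (`‖R k μ i − 1‖ ≤ α∕ℓ_k`), `norm_tau_sub_le_of_reg` (`‖R k μ (i + e_ν) − R k μ i‖ ≤ β∕ℓ_k²`), and the END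
  `norm_plaquette_sub_one_le_of_reg : RegularTransporters L M R α β → (∀ k μ i, R k μ i ∈ unitaryGroup) →
  ‖R k μ i · R k ν (τ_μ i) · (R k μ (τ_ν i))⋆ · (R k ν i)⋆ − 1‖ ≤ (2β + 2α²)∕(lev L k)²`.
The `dist1`∕`GaugeField` reading (through `ι` with `‖ι g − 1‖ = dist1 g`, `SubstrateBackgroundTransporters.regularTransporters_towerOf`) is one
rewrite away and left to the consumer (κ-L1∕κ-END).  0 sorry; axioms ⊆ {propext, Classical.choice, Quot.sound}.
-/

noncomputable section

open scoped Matrix Matrix.Norms.L2Operator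

namespace Summit.QuantumFields.BalabanUV.T4Continuum.B13AvgCorrPlaquette

variable {o : Type*} [Fintype o] [DecidableEq o]

/-- [folklore] right multiplication by a unitary matrix is an isometry for the `ℓ²`-operator norm. -/
theorem norm_mul_unitary (x : Matrix o o ℂ) {u : Matrix o o ℂ} (hu : u ∈ Matrix.unitaryGroup o ℂ) : ‖x * u‖ = ‖x‖ :=
  CStarRing.norm_mul_mem_unitary x hu

/-- [folklore] **COMMUTATOR**: `‖a·b − b·a‖ ≤ 2‖a − 1‖·‖b − 1‖`. -/
theorem norm_commutator_le (a b : Matrix o o ℂ) : ‖a * b - b * a‖ ≤ 2 * (‖a - 1‖ * ‖b - 1‖) := by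
  have e : a * b - b * a = (a - 1) * (b - 1) - (b - 1) * (a - 1) := by noncomm_ring
  rw [e, two_mul]
  refine (norm_sub_le _ _).trans (add_le_add (norm_mul_le _ _) ?_)
  rw [mul_comm]; exact norm_mul_le _ _

/-- [folklore] **THE PLAQUETTE BOUND**: for unitary `c, d` and any `a, b`,
`‖a·b·c⁻¹·d⁻¹ − 1‖ ≤ ‖b − d‖·‖a‖ + ‖a − c‖ + 2‖a − 1‖·‖b − 1‖` — with `a, c` the two `μ`-bonds and `b, d` the two `ν`-bonds of a plaquette,
the first two terms are the lattice-Lipschitz letters and the last the commutator (size²). -/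
theorem norm_plaquette_sub_one_le (a b : Matrix o o ℂ) {c d : Matrix o o ℂ} (hc : c ∈ Matrix.unitaryGroup o ℂ)
    (hd : d ∈ Matrix.unitaryGroup o ℂ) :
    ‖a * b * star c * star d - 1‖ ≤ ‖b - d‖ * ‖a‖ + ‖a - c‖ + 2 * (‖a - 1‖ * ‖b - 1‖) := by
  -- multiply by the unitary `d * c` on the right: `‖X − 1‖ = ‖X·(d c) − d c‖ = ‖a b − d c‖`
  have hdc : d * c ∈ Matrix.unitaryGroup o ℂ := mul_mem hd hc
  have hcc : star c * c = 1 := Matrix.mem_unitaryGroup_iff'.1 hc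
  have hdd : star d * d = 1 := Matrix.mem_unitaryGroup_iff'.1 hd
  have key : (a * b * star c * star d - 1) * (d * c) = a * b - d * c := by
    have : a * b * star c * star d * (d * c) = a * b := by
      calc a * b * star c * star d * (d * c) = a * b * star c * (star d * d) * c := by noncomm_ring
        _ = a * b := by rw [hdd, mul_one, mul_assoc, hcc, mul_one]
    rw [sub_mul, one_mul, this]
  rw [← norm_mul_unitary _ hdc, key]
  have e : a * b - d * c = (a * b - b * a) + (b - d) * a + d * (a - c) := by noncomm_ring
  rw [e]
  have hd1 : ‖d‖ ≤ 1 := by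
    rcases isEmpty_or_nonempty o with ho | ho
    · have : d = 0 := Subsingleton.elim _ _
      rw [this, norm_zero]; exact zero_le_one
    · exact (CStarRing.norm_of_mem_unitary hd).le
  calc ‖a * b - b * a + (b - d) * a + d * (a - c)‖
      ≤ ‖a * b - b * a‖ + ‖(b - d) * a‖ + ‖d * (a - c)‖ := norm_add₃_le
    _ ≤ 2 * (‖a - 1‖ * ‖b - 1‖) + ‖b - d‖ * ‖a‖ + ‖d‖ * ‖a - c‖ :=
        add_le_add (add_le_add (norm_commutator_le a b) (norm_mul_le _ _)) (norm_mul_le _ _)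
    _ ≤ 2 * (‖a - 1‖ * ‖b - 1‖) + ‖b - d‖ * ‖a‖ + 1 * ‖a - c‖ := by gcongr
    _ = ‖b - d‖ * ‖a‖ + ‖a - c‖ + 2 * (‖a - 1‖ * ‖b - 1‖) := by ring

/-! ## §2 In the tower currency of rows NE2 ∕ B5: the plaquette of a unitary (α, β)-regular level is within `(2β + 2α²)∕(lev L k)²` of `1` -/

section Tower

open Literature.MathematicalPhysics.QuantumFieldTheory.Balaban1983to89.B5Prop11Plancherel (fine Tor)
open Literature.MathematicalPhysics.QuantumFieldTheory.Balaban1983to89.B5G183RateUnitTower (lev lev_neZero)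
open Summit.QuantumFields.BalabanUV.T4Continuum.BalabanAveragedTowerUnit (idx one_le_lev')
open Summit.QuantumFields.BalabanUV.T4Continuum.BlockPairingGeometry (tau)
open Summit.QuantumFields.BalabanUV.T4Continuum.RegularBackgroundTower (RegularTransporters connTower connTower_tau_sub connTower_lipschitz)

variable {d : ℕ} (L : ℕ) [NeZero L] (M : Fin d → ℕ) [hM : ∀ μ, NeZero (M μ)]
variable {R : (k : ℕ) → Fin d → (idx L M k → Matrix o o ℂ)} {α β : ℝ}

omit hM in
/-- [folklore] plain size: `‖R k μ i − 1‖ ≤ α∕lev L k`. -/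
theorem norm_sub_one_le_of_reg (h : RegularTransporters L M R α β) (k : ℕ) (μ : Fin d) (i : idx L M k) :
    ‖R k μ i - 1‖ ≤ α / (lev L k : ℕ) := by
  have hℓ : (0 : ℝ) < (lev L k : ℕ) := by exact_mod_cast one_le_lev' L k
  have h1 := h.size k μ i
  rw [norm_smul, Complex.norm_natCast] at h1
  rw [le_div_iff₀ hℓ, mul_comm]; exact h1

omit hM in
/-- [folklore] plain Lipschitz: `‖R k μ (i + e_ν) − R k μ i‖ ≤ β∕(lev L k)²`. -/
theorem norm_tau_sub_le_of_reg (h : RegularTransporters L M R α β) (k : ℕ) (μ ν : Fin d) (i : idx L M k) :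
    ‖R k μ (tau (fine (lev L k) M) ν i) - R k μ i‖ ≤ β / ((lev L k : ℕ) : ℝ) ^ 2 := by
  have hℓ : (0 : ℝ) < (lev L k : ℕ) := by exact_mod_cast one_le_lev' L k
  have h1 := connTower_lipschitz h k μ ν i
  rw [connTower_tau_sub, norm_smul, Complex.norm_natCast] at h1
  rw [sq, ← div_div, le_div_iff₀ hℓ, mul_comm]; exact h1

omit hM in
/-- [folklore] **THE PLAQUETTE OF A UNITARY (α, β)-REGULAR LEVEL**: with `a = R k μ i`, `b = R k ν (i + e_μ)`, `c = R k μ (i + e_ν)`, `d = R k ν i`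
unitary, `‖a·b·c⋆·d⋆ − 1‖ ≤ (2β + 2α²)∕(lev L k)²` — the finest-plaquette letter κ-L2 of the κ-discharge (GAPS § G-ne5p1-Javg-reg; T4-DAG Q49 (a′)). -/
theorem norm_plaquette_sub_one_le_of_reg (h : RegularTransporters L M R α β)
    (hU : ∀ k μ (i : idx L M k), R k μ i ∈ Matrix.unitaryGroup o ℂ) (k : ℕ) (μ ν : Fin d) (i : idx L M k) :
    ‖R k μ i * R k ν (tau (fine (lev L k) M) μ i) * star (R k μ (tau (fine (lev L k) M) ν i)) * star (R k ν i) - 1‖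
      ≤ (2 * β + 2 * α ^ 2) / ((lev L k : ℕ) : ℝ) ^ 2 := by
  have hℓ1 : (1 : ℝ) ≤ (lev L k : ℕ) := by exact_mod_cast one_le_lev' L k
  have hℓ : (0 : ℝ) < (lev L k : ℕ) := by linarith
  have hα : 0 ≤ α := h.nonneg.1
  have ha1 : ‖R k μ i‖ ≤ 1 := by
    rcases isEmpty_or_nonempty o with ho | ho
    · have : R k μ i = 0 := Subsingleton.elim _ _
      rw [this, norm_zero]; exact zero_le_one
    · exact (CStarRing.norm_of_mem_unitary (hU k μ i)).le
  have hmain := norm_plaquette_sub_one_le (R k μ i) (R k ν (tau (fine (lev L k) M) μ i)) (hU k μ (tau (fine (lev L k) M) ν i)) (hU k ν i)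
  refine hmain.trans ?_
  have hbd : ‖R k ν (tau (fine (lev L k) M) μ i) - R k ν i‖ ≤ β / ((lev L k : ℕ) : ℝ) ^ 2 := norm_tau_sub_le_of_reg L M h k ν μ i
  have hac : ‖R k μ i - R k μ (tau (fine (lev L k) M) ν i)‖ ≤ β / ((lev L k : ℕ) : ℝ) ^ 2 := by
    rw [norm_sub_rev]; exact norm_tau_sub_le_of_reg L M h k μ ν i
  have ha : ‖R k μ i - 1‖ ≤ α / (lev L k : ℕ) := norm_sub_one_le_of_reg L M h k μ i
  have hb : ‖R k ν (tau (fine (lev L k) M) μ i) - 1‖ ≤ α / (lev L k : ℕ) := norm_sub_one_le_of_reg L M h k ν _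
  have hβ0 : 0 ≤ β / ((lev L k : ℕ) : ℝ) ^ 2 := div_nonneg h.nonneg.2 (by positivity)
  calc ‖R k ν (tau (fine (lev L k) M) μ i) - R k ν i‖ * ‖R k μ i‖ + ‖R k μ i - R k μ (tau (fine (lev L k) M) ν i)‖
        + 2 * (‖R k μ i - 1‖ * ‖R k ν (tau (fine (lev L k) M) μ i) - 1‖)
      ≤ β / ((lev L k : ℕ) : ℝ) ^ 2 * 1 + β / ((lev L k : ℕ) : ℝ) ^ 2 + 2 * (α / (lev L k : ℕ) * (α / (lev L k : ℕ))) := by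
        gcongr
    _ = (2 * β + 2 * α ^ 2) / ((lev L k : ℕ) : ℝ) ^ 2 := by field_simp; ring

end Tower

end Summit.QuantumFields.BalabanUV.T4Continuum.B13AvgCorrPlaquette

end
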